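import Summits.BirchSwinnertonDyer.BirchSwinnertonDyer.Theorems.ByReductionTypeAtTwoOrdIsogenyRescale
import HarnessLib

/-!
# The `μ`-SHIFT LAW at analytic rank `0` and the ISOGENY TRANSPORT of the Kato half of the `2`-adic
# main conjecture (route ByReductionTypeAtTwo / TwoAdicConverse, cruxes `OrdKatoHalfAtTwo` /
# `OrdEisensteinHalfAtTwo`, item stmt-BirchSwinnertonDyer-19272; seat bsd-2adic-ord-3, GEN 3)

HONEST FRAMING (cell `bsd-2adic`, HUMAN RULINGS D-0036/D-0074): THEOREMS ONLY — no definition, no named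
fact, nothing asserted, closes nothing. PUBLISHED inputs are displayed hypotheses exactly as in the GEN 2
files: Kato 17.4 (1)(2) AT `2` (`h17`, for the curve at which a conclusion is drawn), Greenberg Thm. 4.1 AT
`2` at BOTH members (`hEC`, `hEC'`), GZK (`hGZK`), Cassels' isogeny invariance of the BSD quotient
(`hCassels`). No Schneider / Perrin-Riou isogeny theorem is used or asserted.

WHAT (GEN 2, `…OrdEisensteinHalfShaIsogeny.lean`: «what does NOT transport for free is the Kato half
itself (the `μ`-invariant of `X` shifts under `2`-isogenies)» — this file transports it).
Let `W ∼ W'` be `ℚ`-isogenous globally minimal curves, good ordinary at `2`, of analytic rank `0`, `f`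
their common newform (any level), `ϖ·Ω_W = Ω⁺_f = ϖ'·Ω_{W'}`, `D`, `D'` cyclotomic dual data.

* (prelude `…OrdIsogenyRescale`: rescaling in `Λ`, bookkeeping along an isogeny.)
* §2 **`mu_add_padicValRat_eq_of_isIsogenous` — THE `μ`-SHIFT LAW AT RANK `0`:**
  `μ(X(W)) + ord₂ ϖ' = μ(X(W')) + ord₂ ϖ`, i.e. `μ(E) − μ(E') = ord₂(Ω_{E'}/Ω_E)` (Greenberg's
  "`μ_E` changes as the period", LNM 1716 p. 121), PROVED here from: the algebraic shift
  `μ − μ' = ord₂ f_X(0) − ord₂ f_{X'}(0)` (`…OrdIsogenyDualMaps`), the rank-`0` dictionary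
  `ord₂ f_X(0) − ord₂ L₀(0) = ord₂ #Ш − ord₂ #Ш_an + ord₂ ϖ − ord₂ ϖ₁` at both members with ONE auxiliary
  `L₀` (GEN 2, from Greenberg 4.1@2), and `#Ш_an(W)/#Ш_an(W') = #Ш(W)/#Ш(W')` (Cassels + `L`-invariance).
* §3 **`exists_mem_charIdeal_of_isIsogenous` — THE KATO HALF TRANSPORTS**: if `ϖ'·L₂(f,α) = ι L₀'` with
  `L₀' ∈ char_Λ X(W')` then `ϖ·L₂(f,α) = ι g` for some `g ∈ char_Λ X(W)` — Néron integrality at `W`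
  INCLUDED (it is forced by `μ(X(W)) ≥ 0`); the `p`-free part is supplied by Kato 17.4 (2) AT `W`
  (`MuZeroUpgrade`), the `μ`-part by §2.

Sequel (`…OrdIsogenyTransport.lean`): the typed statements `X5.O1.MainConjectureLowerDivisibilityAtTwoOrd`,
`MazurMainConjecture · 2`, `X5.O1.MainConjectureEisensteinDivisibilityAtTwo` transport member to member on
the rank-`0` good-ordinary locus; the habitat-scope caveat of items 19271/19272 disappears.

References: R. Greenberg, LNM 1716 (1999), Thm. 4.1 (p. 102), §5 p. 121 (isogenies and `μ`); K. Kato,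
Astérisque 295 (2004), Thm. 17.4; J. W. S. Cassels, J. reine angew. Math. 217 (1965); B. Perrin-Riou,
Mém. SMF 17 (1984); P. Schneider, J. Indian Math. Soc. 52 (1987); L. Washington, GTM 83, §13.2.
-/

set_option autoImplicit false
set_option linter.dupNamespace false

noncomputable section

open scoped Classical MatrixGroups ModularForm

open CongruenceSubgroup WeierstrassCurve Literature.NumberTheory.EllipticCurves
  Literature.NumberTheory.EllipticCurves.ModularForms Literature.NumberTheory.EllipticCurves.Rank1Residual
  Literature.NumberTheory.EllipticCurves.Rank1Residual.Typed
  Summit.BirchSwinnertonDyer.Rank1Residual.X1.MuLambda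
  Summit.BirchSwinnertonDyer.Rank1Residual.X1.MuPart
  Summit.BirchSwinnertonDyer.Rank1Residual.X1.ParitySqueeze
  Summit.BirchSwinnertonDyer.Rank1Residual Summit.BirchSwinnertonDyer.Rank1Residual.X5
  Summit.BirchSwinnertonDyer.BirchSwinnertonDyer.Theorems.EisensteinShaCurrency
  Summit.BirchSwinnertonDyer.BirchSwinnertonDyer.Theorems.LambdaConstPinch
  Summit.BirchSwinnertonDyer.Rank1Residual.Additive.TameBranchLambdaParity

universe u

namespace Summit.BirchSwinnertonDyer.BirchSwinnertonDyer.Theorems.IsogenyMuShift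

/-! ## §2 THE `μ`-SHIFT LAW at analytic rank `0` -/

section MuShift

variable {W W' : WeierstrassCurve ℚ} [W.IsElliptic] [W'.IsElliptic] [W.IsGloballyMinimal]
  [W'.IsGloballyMinimal]

/-- **THE `μ`-SHIFT LAW AT ANALYTIC RANK `0` (Greenberg's "`μ_E − μ_{E'} = ord_p(Ω_{E'}/Ω_E)`" at
`p = 2`, PROVED from Thm. 4.1 + Cassels, no Schneider–Perrin-Riou).** `W ∼ W'` ℚ-isogenous globally
minimal curves, `W` good ordinary at `2` with `L(E,1) ≠ 0`; PUB: Greenberg 4.1 AT `2` at both (`hEC`,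
`hEC'`), GZK, Cassels (`hCassels`); a cyclotomic datum `(κ, γ)`, the common newform `f` (any level), dual
data `D`, `D'` with `X(W)` torsion (e.g. Kato 17.4 (1)), and period ratios `ϖ·Ω_W = Ω⁺_f = ϖ'·Ω_{W'}`.
Then **`μ(X(W)) + ord₂ ϖ' = μ(X(W')) + ord₂ ϖ`**. Proof: `μ − μ' = ord₂ f_X(0) − ord₂ f_{X'}(0)`
(pseudo-isogeny, `…OrdIsogenyDualMaps`); the rank-`0` dictionary at both members with one auxiliary
integral `L₀ = ϖ₁·L₂(f,α)` gives `ord₂ f_X(0) − ord₂ f_{X'}(0) = (ord₂ #Ш − ord₂ #Ш') − (ord₂ #Ш_an −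
ord₂ #Ш'_an) + ord₂ ϖ − ord₂ ϖ'`, and `#Ш_an/#Ш'_an = #Ш/#Ш'` (Cassels + `L(W,1) = L(W',1)`).
[cite: GreenbergLNM1716, Thm. 4.1 (p. 102) and §5 p. 121 («μ-invariant can change under isogeny … as the period»)]
[cite: MilneADT2006, Thm. I.7.3 (Cassels)] [cite: Knapp1993, Thm. 11.67] -/
theorem mu_add_padicValRat_eq_of_isIsogenous (hCassels : bsdRHS_eq_of_isIsogenous)
    (hiso : IsIsogenous W W') (hEC : O1.TwoAdicEulerCharRankZero W 0)
    (hEC' : O1.TwoAdicEulerCharRankZero W' 0) (hGZK : rank_eq_analyticRank_of_analyticRank_le_one)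
    (hord : IsOrdinaryAt W 2) (hL : W.entireLFunction 1 ≠ 0)
    {κ : ZpExtension ℚ 2} {γ : Field.absoluteGaloisGroup ℚ} {N : ℕ} [NeZero N]
    {f : CuspForm (Gamma0 N) 2} (hκ : κ.IsCyclotomic) (hγ : κ.IsTopGenerator γ)
    (hγ' : IsCyclotomicVariable 2 γ) (hf : IsNewformOf W f) (D : W.SelmerDualData κ γ)
    (D' : W'.SelmerDualData κ γ) (hX : D.IsTorsion) {ϖ ϖ' : ℚ}
    (hϖ : (ϖ : ℝ) * W.realPeriodRat = plusPeriod f) (hϖ' : (ϖ' : ℝ) * W'.realPeriodRat = plusPeriod f) :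
    (D.mu : ℤ) + padicValRat 2 ϖ' = (D'.mu : ℤ) + padicValRat 2 ϖ := by
  haveI : Module.Finite (IwasawaAlgebra 2) D.X := D.module_finite_holds hγ
  haveI : Module.Finite (IwasawaAlgebra 2) D'.X := D'.module_finite_holds hγ
  have hX' : D'.IsTorsion := isTorsion_of_isIsogenous hiso D D' hX
  have hord' : IsOrdinaryAt W' 2 := isOrdinaryAt_of_isIsogenous hiso hord
  have hL' : W'.entireLFunction 1 ≠ 0 := entireLFunction_one_ne_zero_of_isIsogenous hiso hL
  have hf' : IsNewformOf W' f := hf.of_isIsogenous hiso.symm_of_charZero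
  have hα : unitRoot W' 2 = unitRoot W 2 := unitRoot_eq_of_isIsogenous hiso hord
  have hϖ0 : ϖ ≠ 0 := X2.varpi_ne_zero_of_isNewformOf hf hϖ
  -- generators and ONE auxiliary integral `L₀ = 2^j·ϖ·L₂(f,α)`
  obtain ⟨fX, hfX⟩ := (charIdeal_isPrincipal_holds 2 D.X).principal
  have hchar : D.charIdeal = Ideal.span {fX} := hfX
  obtain ⟨fX', hfX'⟩ := (charIdeal_isPrincipal_holds 2 D'.X).principal
  have hchar' : D'.charIdeal = Ideal.span {fX'} := hfX'
  obtain ⟨j, L₀, -, hL₀⟩ := EisensteinLowerBounds.exists_integral_slack W hord hf hϖ0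
  have hϖ₁0 : (2 : ℚ) ^ j * ϖ ≠ 0 := mul_ne_zero (pow_ne_zero j two_ne_zero) hϖ0
  have hL₀' : iwasawaToPowerSeries 2 L₀ =
      PowerSeries.C (((2 : ℚ) ^ j * ϖ : ℚ) : ℚ_[2]) * padicLFunction f (unitRoot W' 2 : ℚ_[2]) := by
    rw [hα]; exact hL₀
  -- the dictionary at both members
  obtain ⟨q, hq, hq0, hfX0, -, hdict⟩ := exists_shaAn_eq_and_valuation_constantCoeff_charGen_eq W hEC
    hGZK hord hL hκ hγ hγ' hf D hX hϖ hϖ₁0 hchar hL₀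
  obtain ⟨q', hq', hq0', -, -, hdict'⟩ := exists_shaAn_eq_and_valuation_constantCoeff_charGen_eq W'
    hEC' hGZK hord' hL' hκ hγ hγ' hf' D' hX' hϖ' hϖ₁0 hchar' hL₀'
  -- the algebraic shift
  obtain ⟨-, -, hshift⟩ :=
    mu_add_valuation_constantCoeff_eq_of_isIsogenous hiso D D' hX hchar hchar' hfX0
  -- Cassels: `#Ш_an(W) = #Ш_an(W')·#Ш(W)/#Ш(W')`
  have hr' : W'.analyticRank = 0 := analyticRank_eq_zero_of_entireLFunction_one_ne_zero W' hL'
  have hfin' : Finite W'.sha := (hGZK W' (by rw [hr']; exact zero_le_one)).2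
  have hlead : W'.leadingLCoeff ≠ 0 := W'.leadingLCoeff_ne_zero_holds hf'.hasEntireLFunction
  obtain ⟨hfin, hkey⟩ := finite_sha_and_shaAn_eq_of_isIsogenous hCassels hiso hfin' hlead
  haveI : Finite W.sha := hfin
  haveI : Finite W'.sha := hfin'
  have hshaQ : (W.shaOrder : ℚ) ≠ 0 := by exact_mod_cast (W.shaOrder_pos hfin).ne'
  have hshaQ' : (W'.shaOrder : ℚ) ≠ 0 := by exact_mod_cast (W'.shaOrder_pos hfin').ne'
  have hqq : q = q' * (W.shaOrder : ℚ) / (W'.shaOrder : ℚ) := by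
    have h1 : ((q : ℚ) : ℂ) = ((q' * (W.shaOrder : ℚ) / (W'.shaOrder : ℚ) : ℚ) : ℂ) := by
      rw [← hq, hkey, hq']; push_cast; rfl
    exact_mod_cast h1
  have hvq : padicValRat 2 q = padicValRat 2 q' + (padicValNat 2 W.shaOrder : ℤ) -
      (padicValNat 2 W'.shaOrder : ℤ) := by
    rw [hqq, padicValRat.div (mul_ne_zero hq0' hshaQ) hshaQ', padicValRat.mul hq0' hshaQ,
      padicValRat.of_nat, padicValRat.of_nat]
  -- assemble
  linarith [hdict, hdict', hshift, hvq]

end MuShift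

/-! ## §3 The KATO HALF transports along an isogeny (Néron integrality included) -/

section KatoTransport

variable {W W' : WeierstrassCurve ℚ} [W.IsElliptic] [W'.IsElliptic] [W.IsGloballyMinimal]
  [W'.IsGloballyMinimal]

variable (W) in
/-- **Membership criterion (Kato's `p`-free part + a `μ`-inequality).** Rank-free, any image: granted
Kato 17.4 (1)(2) AT `2` for `(W, f)` (`h17`), an integral `L₀` with `ι L₀ = ϖ·L₂(f,α)` lies in
`char_Λ X(E/ℚ_∞)` as soon as `μ(X) ≤ μ(L₀)` — the pattern of the tree's
`mainConjectureLowerDivisibilityAtTwoOrd_of_katoMuPartAtTwo`, isolated at datum level.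
[cite: Kato2004Asterisque, Thm. 17.4 (1)(2) (p. 273)] [cite: GreenbergVatsal2000, p. 4 (after Thm. (1.2))] -/
theorem mem_charIdeal_of_mu_le {N : ℕ} [NeZero N] {f : CuspForm (Gamma0 N) 2}
    (h17 : kato_divisibility_allPrimes W 2 (f := f))
    {κ : ZpExtension ℚ 2} {γ : Field.absoluteGaloisGroup ℚ} (hκ : κ.IsCyclotomic)
    (hγ : κ.IsTopGenerator γ) (hγ' : IsCyclotomicVariable 2 γ) (hord : IsOrdinaryAt W 2)
    (hf : IsNewformOf W f) (D : W.SelmerDualData κ γ) {ϖ : ℚ} {L₀ : IwasawaAlgebra 2} (hL₀0 : L₀ ≠ 0)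
    (hL₀ : iwasawaToPowerSeries 2 L₀ =
      PowerSeries.C (ϖ : ℚ_[2]) * padicLFunction f (unitRoot W 2 : ℚ_[2])) (hμ : D.mu ≤ mu L₀) :
    L₀ ∈ D.charIdeal := by
  haveI : Module.Finite (IwasawaAlgebra 2) D.X := D.module_finite_holds hγ
  obtain ⟨fE, hfE⟩ := (charIdeal_isPrincipal_holds 2 D.X).principal
  have hchar : D.charIdeal = Ideal.span {fE} := hfE
  obtain ⟨hD, a, n, hkey⟩ :=
    O1.MuZeroUpgrade.exists_mul_charGen_eq_of_kato_allPrimes W 2 h17 hκ hγ hγ' hord hf D hchar hL₀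
  have hden0 : (PowerSeries.C (ϖ.den : ℤ_[2]) : IwasawaAlgebra 2) ≠ 0 := fun h0 =>
    ϖ.den_nz (by exact_mod_cast (PowerSeries.C_injective (h0.trans (map_zero _).symm) :
      ((ϖ.den : ℕ) : ℤ_[2]) = 0))
  have hdL0 : PowerSeries.C (ϖ.den : ℤ_[2]) * L₀ ≠ 0 := mul_ne_zero hden0 hL₀0
  have hfE0 : fE ≠ 0 := by
    rintro rfl
    rw [mul_zero] at hkey
    exact mul_ne_zero (C_pow_ne_zero n) hdL0 hkey.symm
  have hμfE : mu fE = D.mu := mu_generator_eq_muInvariant D.X hD hfE0 hchar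
  have hle : mu fE ≤ mu L₀ := by rw [hμfE]; exact hμ
  have hle' : mu fE ≤ mu (PowerSeries.C (ϖ.den : ℤ_[2]) * L₀) := by
    rw [mul_comm]; exact hle.trans (mu_le_mu_mul hL₀0 hden0)
  have h1 : PowerSeries.C (ϖ.den : ℤ_[2]) * L₀ ∈ Ideal.span {fE} :=
    O1.MuZeroUpgrade.mem_span_of_mul_eq_C_pow_mul_of_mu_le hfE0 hkey hle'
  rw [hchar]
  exact O1.MuZeroUpgrade.mem_span_of_C_natCast_mul_mem_span hfE0 ϖ.den_nz hle h1

/-- **THE KATO HALF OF THE `2`-ADIC MAIN CONJECTURE TRANSPORTS ALONG ISOGENIES (datum level, analytic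
rank `0`).** `W ∼ W'` ℚ-isogenous globally minimal, `W` good ordinary at `2` with `L(E,1) ≠ 0`; PUB:
Kato 17.4 (1)(2) AT `2` for `W` (`h17`), Greenberg 4.1 AT `2` at both, GZK, Cassels; `(κ, γ)` cyclotomic,
`f` the common newform, `D`, `D'` dual data, `ϖ·Ω_W = Ω⁺_f = ϖ'·Ω_{W'}`. IF `ϖ'·L₂(f,α) = ι L₀'` with
`L₀' ∈ char_Λ X(W')` (the Kato–Néron half at the datum `D'`) THEN `ϖ·L₂(f,α) = ι g` for some
`g ∈ char_Λ X(W)` — integrality of `ϖ·L₂` at `W` INCLUDED. Proof: `μ(X(W')) ≤ μ(L₀')`; the `μ`-shift law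
(§2) turns this into `0 ≤ μ(X(W)) ≤ ord₂ ϖ + μ(L₂)`, so the rescaled `g` exists with `μ(g) ≥ μ(X(W))`, and
Kato 17.4 (2) at `W` supplies the `p`-free part (`mem_charIdeal_of_mu_le`).
[cite: Kato2004Asterisque, Thm. 17.4 (1)(2) (p. 273)] [cite: GreenbergLNM1716, Thm. 4.1 (p. 102) and §5 p. 121]
[cite: MilneADT2006, Thm. I.7.3 (Cassels)] -/
theorem exists_mem_charIdeal_of_isIsogenous (hCassels : bsdRHS_eq_of_isIsogenous)
    (hiso : IsIsogenous W W') {N : ℕ} [NeZero N] {f : CuspForm (Gamma0 N) 2}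
    (h17 : kato_divisibility_allPrimes W 2 (f := f)) (hEC : O1.TwoAdicEulerCharRankZero W 0)
    (hEC' : O1.TwoAdicEulerCharRankZero W' 0) (hGZK : rank_eq_analyticRank_of_analyticRank_le_one)
    (hord : IsOrdinaryAt W 2) (hL : W.entireLFunction 1 ≠ 0)
    {κ : ZpExtension ℚ 2} {γ : Field.absoluteGaloisGroup ℚ} (hκ : κ.IsCyclotomic)
    (hγ : κ.IsTopGenerator γ) (hγ' : IsCyclotomicVariable 2 γ) (hf : IsNewformOf W f)
    (D : W.SelmerDualData κ γ) (D' : W'.SelmerDualData κ γ) {ϖ ϖ' : ℚ}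
    (hϖ : (ϖ : ℝ) * W.realPeriodRat = plusPeriod f) (hϖ' : (ϖ' : ℝ) * W'.realPeriodRat = plusPeriod f)
    {L₀' : IwasawaAlgebra 2}
    (hL₀' : iwasawaToPowerSeries 2 L₀' =
      PowerSeries.C (ϖ' : ℚ_[2]) * padicLFunction f (unitRoot W' 2 : ℚ_[2]))
    (hmem' : L₀' ∈ D'.charIdeal) :
    ∃ g ∈ D.charIdeal, iwasawaToPowerSeries 2 g =
      PowerSeries.C (ϖ : ℚ_[2]) * padicLFunction f (unitRoot W 2 : ℚ_[2]) := by
  haveI : Module.Finite (IwasawaAlgebra 2) D.X := D.module_finite_holds hγ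
  haveI : Module.Finite (IwasawaAlgebra 2) D'.X := D'.module_finite_holds hγ
  have hX : D.IsTorsion := (h17 κ γ hκ hγ hγ' hord hf D).1
  have hX' : D'.IsTorsion := isTorsion_of_isIsogenous hiso D D' hX
  have hord' : IsOrdinaryAt W' 2 := isOrdinaryAt_of_isIsogenous hiso hord
  have hf' : IsNewformOf W' f := hf.of_isIsogenous hiso.symm_of_charZero
  have hα : unitRoot W' 2 = unitRoot W 2 := unitRoot_eq_of_isIsogenous hiso hord
  have hϖ0 : ϖ ≠ 0 := X2.varpi_ne_zero_of_isNewformOf hf hϖ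
  have hϖ'0 : ϖ' ≠ 0 := X2.varpi_ne_zero_of_isNewformOf hf' hϖ'
  have hϖQ : ((ϖ : ℚ) : ℚ_[2]) ≠ 0 := by exact_mod_cast hϖ0
  have hϖ'Q : ((ϖ' : ℚ) : ℚ_[2]) ≠ 0 := by exact_mod_cast hϖ'0
  have hL₀'0 : L₀' ≠ 0 := ne_zero_of_iwasawaToPowerSeries_eq W' hord' hf' hϖ'0 hL₀'
  -- the integral `L₂(f,α)` at `2` (INT2-AUTO) and the `μ` of `L₀'`
  obtain ⟨G, hG⟩ := exists_iwasawaToPowerSeries_eq_padicLFunction_two_auto hord hf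
  have hG0 : G ≠ 0 := by
    intro h0
    rw [h0, map_zero] at hG
    exact padicLFunction_unitRoot_ne_zero hord hf hG.symm
  rw [hα, ← hG] at hL₀'
  obtain ⟨-, hμL₀'⟩ := mu_eq_of_iwasawaToPowerSeries_eq_C_mul hG0 hL₀'0 hϖ'Q hL₀'
  rw [Padic.valuation_ratCast] at hμL₀'
  -- `μ(X(W')) ≤ μ(L₀')` from `f_{X'} ∣ L₀'`
  obtain ⟨fX', hfX'⟩ := (charIdeal_isPrincipal_holds 2 D'.X).principal
  have hchar' : D'.charIdeal = Ideal.span {fX'} := hfX'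
  have hμ'le : D'.mu ≤ mu L₀' := by
    rw [hchar'] at hmem'
    obtain ⟨c, hc⟩ := Ideal.mem_span_singleton'.mp hmem'
    have hfX'0 : fX' ≠ 0 := by rintro rfl; exact hL₀'0 (by rw [← hc, mul_zero])
    have hc0 : c ≠ 0 := by rintro rfl; exact hL₀'0 (by rw [← hc, zero_mul])
    have hμ' : mu fX' = D'.mu := mu_generator_eq_muInvariant D'.X hX' hfX'0 hchar'
    rw [← hμ', ← hc, mul_comm]
    exact mu_le_mu_mul hfX'0 hc0
  -- the `μ`-shift law
  have hshift := mu_add_padicValRat_eq_of_isIsogenous hCassels hiso hEC hEC' hGZK hord hL hκ hγ hγ' hf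
    D D' hX hϖ hϖ'
  -- the rescaled element at `W`
  have hineq : 0 ≤ ((ϖ : ℚ) : ℚ_[2]).valuation + mu G := by
    rw [Padic.valuation_ratCast]
    have h0 : (0 : ℤ) ≤ D.mu := by exact_mod_cast Nat.zero_le _
    have h1 : (D'.mu : ℤ) ≤ mu L₀' := by exact_mod_cast hμ'le
    linarith
  obtain ⟨g, hg0, hg, hμg⟩ := exists_integral_rescale hG0 hϖQ hineq
  rw [Padic.valuation_ratCast] at hμg
  rw [hG] at hg
  refine ⟨g, mem_charIdeal_of_mu_le W h17 hκ hγ hγ' hord hf D hg0 hg ?_, hg⟩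
  have h1 : (D'.mu : ℤ) ≤ mu L₀' := by exact_mod_cast hμ'le
  have h2 : (D.mu : ℤ) ≤ mu g := by linarith
  exact_mod_cast h2

end KatoTransport

/-! ## §4 Greenberg's `μ_E = m_E` at `2` on the rank-`0` locus: `μ` at every member from the `μ = 0` member -/

section MuFormula

variable {W W' : WeierstrassCurve ℚ} [W.IsElliptic] [W'.IsElliptic] [W.IsGloballyMinimal]
  [W'.IsGloballyMinimal]

/-- **`μ` at every member of a rank-`0` class from its `μ = 0` member (Greenberg's `μ_E = m_E` at `2`).**
Same PUB inputs as the `μ`-shift law; if the cyclotomic datum `D'` of the isogenous member `W'` has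
`μ(X(W')) = 0` (e.g. the Prop-5.14 member, or a tower-gap certificate), then for any datum `D` of `W` over
the same `(κ, γ)`: **`μ(X(W)) = ord₂ ϖ − ord₂ ϖ' = ord₂(Ω_{W'}/Ω_W)`** — the exact power of `2` by which the
Néron period drops from `W'` to `W`. So on K4's rank-`0` domain the `μ`-invariant of every member of a
ℚ-isogeny class is READ OFF one member's `μ = 0` certificate and the period ratios; in particular
`ord₂ ϖ' ≤ ord₂ ϖ`: the `μ = 0` member has the `2`-adically smallest `ϖ` (largest Néron period).
[cite: GreenbergLNM1716, §1 p. 64 (Conj. 1.11 «effectively predicts the value of μ_E») and §5 p. 175 (conductor 15 at p = 2)]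
[cite: MilneADT2006, Thm. I.7.3 (Cassels)] -/
theorem mu_eq_padicValRat_sub_of_mu_eq_zero (hCassels : bsdRHS_eq_of_isIsogenous)
    (hiso : IsIsogenous W W') (hEC : O1.TwoAdicEulerCharRankZero W 0)
    (hEC' : O1.TwoAdicEulerCharRankZero W' 0) (hGZK : rank_eq_analyticRank_of_analyticRank_le_one)
    (hord : IsOrdinaryAt W 2) (hL : W.entireLFunction 1 ≠ 0)
    {κ : ZpExtension ℚ 2} {γ : Field.absoluteGaloisGroup ℚ} {N : ℕ} [NeZero N]
    {f : CuspForm (Gamma0 N) 2} (hκ : κ.IsCyclotomic) (hγ : κ.IsTopGenerator γ)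
    (hγ' : IsCyclotomicVariable 2 γ) (hf : IsNewformOf W f) (D : W.SelmerDualData κ γ)
    (D' : W'.SelmerDualData κ γ) (hX : D.IsTorsion) {ϖ ϖ' : ℚ}
    (hϖ : (ϖ : ℝ) * W.realPeriodRat = plusPeriod f) (hϖ' : (ϖ' : ℝ) * W'.realPeriodRat = plusPeriod f)
    (hμ' : D'.mu = 0) :
    (D.mu : ℤ) = padicValRat 2 ϖ - padicValRat 2 ϖ' ∧ padicValRat 2 ϖ' ≤ padicValRat 2 ϖ := by
  have h := mu_add_padicValRat_eq_of_isIsogenous hCassels hiso hEC hEC' hGZK hord hL hκ hγ hγ' hf D D' hX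
    hϖ hϖ'
  rw [hμ', Nat.cast_zero, zero_add] at h
  have h0 : (0 : ℤ) ≤ D.mu := by exact_mod_cast Nat.zero_le _
  exact ⟨by linarith, by linarith⟩

/-- **Conversely `μ = 0` transports to every member whose `ϖ` has the same `2`-adic valuation** (e.g.
members with the same Néron period up to odd factors): under the hypotheses above, `ord₂ ϖ = ord₂ ϖ'`
and `μ(X(W')) = 0` give `μ(X(W)) = 0`. [cite: GreenbergLNM1716, §1 p. 64 and §5 p. 175] -/
theorem mu_eq_zero_of_isIsogenous_of_padicValRat_eq (hCassels : bsdRHS_eq_of_isIsogenous)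
    (hiso : IsIsogenous W W') (hEC : O1.TwoAdicEulerCharRankZero W 0)
    (hEC' : O1.TwoAdicEulerCharRankZero W' 0) (hGZK : rank_eq_analyticRank_of_analyticRank_le_one)
    (hord : IsOrdinaryAt W 2) (hL : W.entireLFunction 1 ≠ 0)
    {κ : ZpExtension ℚ 2} {γ : Field.absoluteGaloisGroup ℚ} {N : ℕ} [NeZero N]
    {f : CuspForm (Gamma0 N) 2} (hκ : κ.IsCyclotomic) (hγ : κ.IsTopGenerator γ)
    (hγ' : IsCyclotomicVariable 2 γ) (hf : IsNewformOf W f) (D : W.SelmerDualData κ γ)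
    (D' : W'.SelmerDualData κ γ) (hX : D.IsTorsion) {ϖ ϖ' : ℚ}
    (hϖ : (ϖ : ℝ) * W.realPeriodRat = plusPeriod f) (hϖ' : (ϖ' : ℝ) * W'.realPeriodRat = plusPeriod f)
    (hμ' : D'.mu = 0) (hv : padicValRat 2 ϖ = padicValRat 2 ϖ') : D.mu = 0 := by
  obtain ⟨h, -⟩ := mu_eq_padicValRat_sub_of_mu_eq_zero hCassels hiso hEC hEC' hGZK hord hL hκ hγ hγ' hf
    D D' hX hϖ hϖ' hμ'
  rw [hv, sub_self] at h
  exact_mod_cast h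

end MuFormula

end Summit.BirchSwinnertonDyer.BirchSwinnertonDyer.Theorems.IsogenyMuShift

end
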